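/-
Copyright (c) 2026 the pub-hodgecm-mathlib formalisation cell (harness21).  Prover seat hodgecm-mathlib-K2E3-p17 (g8), Track B «K2-LIT» ∕ h413
(`stmt-HodgeConjecture-24833`), line `K2_E3_EllipticInputs`, leaf (nsc-S-A′), H-layer brick LEV-3, mirror (lev′) of `MEMO-H4-residues.v1.K2E3-p25-g0.md` §1
(architect K2E3-p25 (g0); dealer K2E3-plan (g4) RULINGS #3 (R-9) D76).  2026-09-04.
-/
import Summits.HodgeConjecture.HodgeConjecture.Theorems.K2E3GL3DegenerateLevelOne     -- ★ LEV-3 (lev) p859300 (this seat) and its chain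
import Literature.NumberTheory.Automorphic.CartanDecompositionGLn                     -- ★ `glTranspose`
import HarnessLib

/-!
# Crux `H413` — K2-LIT E3, H-layer rule (lev′), THE MIRROR: a `ψ_nd`- and `ψ‴`-DEGENERATE irreducible smooth representation of `GL₃(F)` is one-dimensional
# (`ψ‴(u) = ψ(u₀₁)`, the character trivial on `U_Q` and generic on `U_{α₁}`), by transport of ★ (lev) along the outer automorphism `ι(g) = w₀ (gᵀ)⁻¹ w₀`

Cell `hodgecm-mathlib`, Track B, line `K2_E3_EllipticInputs`, leaf (nsc-S-A′); H-layer rule (lev′) = the mirror of ★ (lev) `K2E3GL3DegenerateLevelOne` named in the architect's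
`MEMO-H4-residues.v1` §1 («(lev′): `ψ‴` instead of `ψ′`, `U_{Q′}` instead of `U_Q`») and used by line «SC′-IRR-lev» (JM-same ∕ JM-cross: a degenerate constituent of `ρ₂ × χ`
has BOTH Jacquet modules non-zero).  THEOREMS ONLY; count-neutral helper (`--supports stmt-HodgeConjecture-24833 --as helper`).

PROOF BY TRANSPORT OF STRUCTURE (no second copy of the (lev) machine).  `ι := Ad(w₀) ∘ (g ↦ (gᵀ)⁻¹)` (★ `glTranspose`, `w₀ = permGL Fin.revPerm`) is a continuous
automorphism of `GL₃(F)` with `ι(U₃) = U₃`, `ι ∘ ι = id`, `(ι u)₀₁ = −u₁₂`, `(ι u)₁₂ = −u₀₁` on `U₃` (§1).  Hence `V_{ω∘ι}(U₃, θ) = V_ω(U₃, θ ∘ ι)` (§2), and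
`θ_{a,b} ∘ ι = θ_{−b,−a}` (`θ_{a,b}(u) = ψ(a u₀₁ + b u₁₂)`); the torus `diag(1,−1,1)` identifies `V(U₃,θ_{−1,−1})` with `V(U₃,ψ_nd)` and `V(U₃,θ_{−1,0})` with
`V(U₃,ψ‴)` (§3).  So `ω` is `ψ_nd`- and `ψ‴`-degenerate iff `ω ∘ ι` (irreducible ★ `isIrreducible_comp_of_surjective`, smooth ★ `IsSmooth.comp`) is `ψ_nd`- and
`ψ′`-degenerate, and ★ (lev) gives: **`finrank_eq_one_of_degenerate'`**, **`apply_eq_self_of_mem_upperUnitriangular_of_degenerate'`** (`U₃` acts trivially),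
**`ker_restrictUnipotentGL_eq_bot_of_degenerate'`**, **`finrank_coinvariants_restrictUnipotentGL_eq_one_of_degenerate'`** (`dim r_B ω = 1`) (§4).

HONEST LABEL: HC_CM is proved only modulo the 7 printed citations (2 remaining named inputs: hLiu418 = stmt-HodgeConjecture-24832, h413 =
stmt-HodgeConjecture-24833) until rung 0 closes; count-neutral helper.

## References
* [BernsteinZelevinskyASENS1977] I. N. Bernstein, A. V. Zelevinsky, *Induced representations of reductive p-adic groups I*, Ann. Sci. ÉNS 10 (1977), Thm. 4.7, §7.1
  (the automorphism `g ↦ (gᵀ)⁻¹`).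
* [Zelevinsky1980] A. V. Zelevinsky, *Induced representations of reductive p-adic groups II*, Ann. Sci. ÉNS 13 (1980), 4.3.
-/

set_option autoImplicit false
-- the mandated namespace repeats `HodgeConjecture.HodgeConjecture`, as in every `Theorems/*.lean` of this sub-problem
set_option linter.dupNamespace false

noncomputable section

open Representation Matrix Literature.NumberTheory.Automorphic Literature.NumberTheory.GaloisRepresentations.IsNonarchimedeanLocalField
open scoped MatrixGroups
open Summit.HodgeConjecture.HodgeConjecture.Cruxes.H413.K2E3TwistedKernelTransport
open Summit.HodgeConjecture.HodgeConjecture.Cruxes.H413.K2E3GL3UnipotentCharacters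
open Summit.HodgeConjecture.HodgeConjecture.Cruxes.H413.K2E3GL3DegenerateLevelOne

namespace Summit.HodgeConjecture.HodgeConjecture.Cruxes.H413.K2E3GL3DegenerateLevelOneMirror

/-! ## §1 The automorphism `ι = Ad(w₀) ∘ transpose-inverse` -/

section Iota

variable {F : Type*} [Field F]

/-- **Entries of `ι(g) = w₀ (gᵀ)⁻¹ w₀⁻¹`**: `(ι g)_{ij} = (g⁻¹)_{rev j, rev i}`. [cite: BernsteinZelevinskyASENS1977, §7.1] -/
theorem coe_iota_apply (g : GL (Fin 3) F) (i j : Fin 3) :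
    (((((glTranspose (Fin 3)).trans (MulEquiv.inv' (GL (Fin 3) F)).symm).trans (MulAut.conj (permGL Fin.revPerm : GL (Fin 3) F))) g : GL (Fin 3) F) : Matrix (Fin 3) (Fin 3) F) i j = ((g⁻¹ : GL (Fin 3) F) : Matrix (Fin 3) (Fin 3) F) (Fin.rev j) (Fin.rev i) := by
  have h1 : ((((glTranspose (Fin 3)).trans (MulEquiv.inv' (GL (Fin 3) F)).symm) g : GL (Fin 3) F) : Matrix (Fin 3) (Fin 3) F) = (((g⁻¹ : GL (Fin 3) F)) : Matrix (Fin 3) (Fin 3) F)ᵀ := by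
    simp [MulEquiv.trans_apply, glTranspose, Matrix.transpose_nonsing_inv]
  rw [MulEquiv.trans_apply, MulAut.conj_apply, coe_permGL_mul_mul_inv, Matrix.submatrix_apply, h1, Matrix.transpose_apply, Fin.revPerm_apply,
    Fin.revPerm_apply]

/-- `ι` is an involution: `ι (ι g) = g`. [cite: BernsteinZelevinskyASENS1977, §7.1] -/
theorem iota_iota (g : GL (Fin 3) F) : (((glTranspose (Fin 3)).trans (MulEquiv.inv' (GL (Fin 3) F)).symm).trans (MulAut.conj (permGL Fin.revPerm : GL (Fin 3) F))) ((((glTranspose (Fin 3)).trans (MulEquiv.inv' (GL (Fin 3) F)).symm).trans (MulAut.conj (permGL Fin.revPerm : GL (Fin 3) F))) g) = g := by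
  refine Units.ext (Matrix.ext fun i j => ?_)
  rw [coe_iota_apply, ← map_inv, coe_iota_apply, inv_inv, Fin.rev_rev, Fin.rev_rev]

/-- `ι` is continuous. [folklore] -/
theorem continuous_iota [TopologicalSpace F] [IsTopologicalRing F] : Continuous ((((glTranspose (Fin 3)).trans (MulEquiv.inv' (GL (Fin 3) F)).symm).trans (MulAut.conj (permGL Fin.revPerm : GL (Fin 3) F))) : GL (Fin 3) F → GL (Fin 3) F) := by
  have h : ((((glTranspose (Fin 3)).trans (MulEquiv.inv' (GL (Fin 3) F)).symm).trans (MulAut.conj (permGL Fin.revPerm : GL (Fin 3) F))) : GL (Fin 3) F → GL (Fin 3) F) = fun g => (permGL Fin.revPerm : GL (Fin 3) F) * (((glTranspose (Fin 3)).trans (MulEquiv.inv' (GL (Fin 3) F)).symm) g) * (permGL Fin.revPerm : GL (Fin 3) F)⁻¹ := by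
    funext g; rfl
  rw [h]
  refine (continuous_const.mul ?_).mul continuous_const
  refine Units.continuous_iff.2 ⟨?_, ?_⟩
  · have h2 : (Units.val ∘ (((glTranspose (Fin 3)).trans (MulEquiv.inv' (GL (Fin 3) F)).symm) : GL (Fin 3) F → GL (Fin 3) F)) = fun g => (((g⁻¹ : GL (Fin 3) F)) : Matrix (Fin 3) (Fin 3) F)ᵀ := by
      funext g; simp [glTranspose, Matrix.transpose_nonsing_inv]
    rw [h2]; exact Units.continuous_coe_inv.matrix_transpose
  · have h2 : (fun g : GL (Fin 3) F => (((((glTranspose (Fin 3)).trans (MulEquiv.inv' (GL (Fin 3) F)).symm) g)⁻¹ : GL (Fin 3) F) : Matrix (Fin 3) (Fin 3) F)) = fun g => ((g : GL (Fin 3) F) : Matrix (Fin 3) (Fin 3) F)ᵀ := by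
      funext g; simp [MulEquiv.trans_apply, glTranspose]
    rw [h2]; exact Units.continuous_val.matrix_transpose

/-- Super-diagonal entries of the inverse of `u ∈ U₃`: `(u⁻¹)₀₁ = −u₀₁`, `(u⁻¹)₁₂ = −u₁₂`. [folklore] -/
theorem inv_superdiag_of_mem_upperUnitriangular {u : GL (Fin 3) F} (hu : u ∈ upperUnitriangular (Fin 3) F) :
    ((u⁻¹ : GL (Fin 3) F) : Matrix (Fin 3) (Fin 3) F) 0 1 = -(u : Matrix (Fin 3) (Fin 3) F) 0 1 ∧
      ((u⁻¹ : GL (Fin 3) F) : Matrix (Fin 3) (Fin 3) F) 1 2 = -(u : Matrix (Fin 3) (Fin 3) F) 1 2 := by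
  obtain ⟨h01, h12⟩ := superdiag_apply_mul hu (Subgroup.inv_mem _ hu)
  rw [mul_inv_cancel, Units.val_one, Matrix.one_apply_ne (by decide)] at h01
  rw [mul_inv_cancel, Units.val_one, Matrix.one_apply_ne (by decide)] at h12
  constructor
  · linear_combination (-1 : F) * h01
  · linear_combination (-1 : F) * h12

/-- **`ι(U₃) ⊆ U₃` with `(ι u)₀₁ = −u₁₂`, `(ι u)₁₂ = −u₀₁`**. [cite: BernsteinZelevinskyASENS1977, §7.1] -/
theorem iota_mem_upperUnitriangular {u : GL (Fin 3) F} (hu : u ∈ upperUnitriangular (Fin 3) F) :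
    (((glTranspose (Fin 3)).trans (MulEquiv.inv' (GL (Fin 3) F)).symm).trans (MulAut.conj (permGL Fin.revPerm : GL (Fin 3) F))) u ∈ upperUnitriangular (Fin 3) F ∧
      (((((glTranspose (Fin 3)).trans (MulEquiv.inv' (GL (Fin 3) F)).symm).trans (MulAut.conj (permGL Fin.revPerm : GL (Fin 3) F))) u : GL (Fin 3) F) : Matrix (Fin 3) (Fin 3) F) 0 1 = -(u : Matrix (Fin 3) (Fin 3) F) 1 2 ∧
      (((((glTranspose (Fin 3)).trans (MulEquiv.inv' (GL (Fin 3) F)).symm).trans (MulAut.conj (permGL Fin.revPerm : GL (Fin 3) F))) u : GL (Fin 3) F) : Matrix (Fin 3) (Fin 3) F) 1 2 = -(u : Matrix (Fin 3) (Fin 3) F) 0 1 := by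
  obtain ⟨i00, i11, i22, i10, i20, i21⟩ := entries_of_mem_upperUnitriangular (Subgroup.inv_mem _ hu)
  obtain ⟨i01, i12⟩ := inv_superdiag_of_mem_upperUnitriangular hu
  have r0 : Fin.rev (0 : Fin 3) = 2 := rfl
  have r1 : Fin.rev (1 : Fin 3) = 1 := rfl
  have r2 : Fin.rev (2 : Fin 3) = 0 := rfl
  refine ⟨mem_upperUnitriangular_of_entries ?_ ?_ ?_ ?_ ?_ ?_, ?_, ?_⟩
  all_goals rw [coe_iota_apply]
  · rw [r0, i22]
  · rw [r1, i11]
  · rw [r2, i00]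
  · rw [r0, r1, i21]
  · rw [r0, r2, i20]
  · rw [r1, r2, i10]
  · rw [r1, r0, i12]
  · rw [r2, r1, i01]

end Iota

/-! ## §2 Twisted kernels along a group endomorphism preserving `U` -/

section Transport

variable {k G V : Type*} [CommRing k] [Group G] [AddCommGroup V] [Module k V] (ω : Representation k G V)

/-- **`V_{ω∘e}(U, θ) = V_ω(U, θ ∘ e|_U)`** for an endomorphism `e` of `G` with `e(U) ⊆ U` and `e (e g) = g` (so `e|_U` is a bijection of `U`).
[cite: BernsteinZelevinskyASENS1977, §7.1] -/
theorem ker_charTwist_comp_eq (e : G →* G) (hee : ∀ g, e (e g) = g) (U : Subgroup G) (heU : ∀ u : ↥U, e u ∈ U) (θ : ↥U →* kˣ) :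
    Coinvariants.ker (Representation.charTwist (ω.comp e) U θ) = Coinvariants.ker (ω.charTwist U (θ.comp ((e.restrict U).codRestrict U heU))) := by
  rw [ker_charTwist_eq_span, ker_charTwist_eq_span]
  refine le_antisymm (Submodule.span_mono ?_) (Submodule.span_mono ?_)
  · rintro _ ⟨⟨u, v⟩, rfl⟩
    refine ⟨(⟨e u, heU u⟩, v), ?_⟩
    simp only [MonoidHom.comp_apply, MonoidHom.codRestrict_apply, MonoidHom.restrict_apply, hee, Subtype.coe_eta]
  · rintro _ ⟨⟨u, v⟩, rfl⟩
    refine ⟨(⟨e u, heU u⟩, v), ?_⟩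
    simp only [MonoidHom.comp_apply, MonoidHom.codRestrict_apply, MonoidHom.restrict_apply, hee]

end Transport

/-! ## §3 The sign flips: the torus `diag(1,−1,1)` -/

section Signs

variable {F : Type*} [Field F] {V : Type*} [AddCommGroup V] [Module ℂ V] (ω : Representation ℂ (GL (Fin 3) F) V) {ψ : AddChar F Circle}

/-- **GENERAL TORUS ON `U₃`**: for `x = diag(d)` and `u ∈ U₃`, `x⁻¹ u x ∈ U₃`, `(x⁻¹ux)₀₁ = d₀⁻¹ u₀₁ d₁`, `(x⁻¹ux)₁₂ = d₁⁻¹ u₁₂ d₂`. [folklore] -/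
theorem torus_conj_upperUnitriangular_gen (d : Fin 3 → Fˣ) {u : GL (Fin 3) F} (hu : u ∈ upperUnitriangular (Fin 3) F) :
    (diagonalGL (Fin 3) F d)⁻¹ * u * diagonalGL (Fin 3) F d ∈ upperUnitriangular (Fin 3) F ∧
      (((diagonalGL (Fin 3) F d)⁻¹ * u * diagonalGL (Fin 3) F d : GL (Fin 3) F) : Matrix (Fin 3) (Fin 3) F) 0 1 =
          ((d 0)⁻¹ : Fˣ) * (u : Matrix (Fin 3) (Fin 3) F) 0 1 * (d 1 : F) ∧
      (((diagonalGL (Fin 3) F d)⁻¹ * u * diagonalGL (Fin 3) F d : GL (Fin 3) F) : Matrix (Fin 3) (Fin 3) F) 1 2 =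
          ((d 1)⁻¹ : Fˣ) * (u : Matrix (Fin 3) (Fin 3) F) 1 2 * (d 2 : F) := by
  have hinv : (diagonalGL (Fin 3) F d)⁻¹ = diagonalGL (Fin 3) F d⁻¹ := (map_inv _ _).symm
  have hinv' : diagonalGL (Fin 3) F d = (diagonalGL (Fin 3) F d⁻¹)⁻¹ := by rw [map_inv, inv_inv]
  rw [hinv, hinv']
  refine ⟨diagonalGL_conj_mem_upperUnitriangular _ hu, ?_, ?_⟩
  · rw [diagonalGL_conj_apply]; simp
  · rw [diagonalGL_conj_apply]; simp

/-- **SIGN FLIP**: `V(U₃, θ_{a,b}) = V ⇒ V(U₃, θ_{−a,−b}) = V`, `θ_{a,b}(u) = ψ(a u₀₁ + b u₁₂)` (conjugation by `diag(1,−1,1)`, ★ kit transport). [folklore] -/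
theorem ker_charTwist_eq_top_of_neg {a b : F} (θ θ' : ↥(upperUnitriangular (Fin 3) F) →* ℂˣ)
    (hθ : ∀ u, ((θ u : ℂˣ) : ℂ) = ψ (a * ((u : GL (Fin 3) F) : Matrix (Fin 3) (Fin 3) F) 0 1 + b * ((u : GL (Fin 3) F) : Matrix (Fin 3) (Fin 3) F) 1 2))
    (hθ' : ∀ u, ((θ' u : ℂˣ) : ℂ) = ψ (-a * ((u : GL (Fin 3) F) : Matrix (Fin 3) (Fin 3) F) 0 1 + -b * ((u : GL (Fin 3) F) : Matrix (Fin 3) (Fin 3) F) 1 2))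
    (htop : Coinvariants.ker (ω.charTwist (upperUnitriangular (Fin 3) F) θ) = ⊤) :
    Coinvariants.ker (ω.charTwist (upperUnitriangular (Fin 3) F) θ') = ⊤ := by
  refine ker_charTwist_eq_top_of_conj ω _ θ θ' (diagonalGL (Fin 3) F ![1, -1, 1]) (fun u => (torus_conj_upperUnitriangular_gen ![1, -1, 1] u.2).1)
    (fun u => Units.ext ?_) htop
  obtain ⟨-, h01, h12⟩ := torus_conj_upperUnitriangular_gen ![1, -1, 1] u.2
  rw [hθ', hθ]
  refine congrArg (fun z : F => ((ψ z : Circle) : ℂ)) ?_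
  change -a * (((diagonalGL (Fin 3) F ![1, -1, 1])⁻¹ * (u : GL (Fin 3) F) * diagonalGL (Fin 3) F ![1, -1, 1] : GL (Fin 3) F) : Matrix (Fin 3) (Fin 3) F) 0 1 +
      -b * (((diagonalGL (Fin 3) F ![1, -1, 1])⁻¹ * (u : GL (Fin 3) F) * diagonalGL (Fin 3) F ![1, -1, 1] : GL (Fin 3) F) : Matrix (Fin 3) (Fin 3) F) 1 2 = _
  rw [h01, h12]
  simp

end Signs

/-! ## §4 Rule (lev′) -/

section Mirror

variable {F : Type*} [Field F] [ValuativeRel F] [TopologicalSpace F] [IsNonarchimedeanLocalField F]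
  {ψ : AddChar F Circle} {V : Type*} [AddCommGroup V] [Module ℂ V] (ω : Representation ℂ (GL (Fin 3) F) V)

omit [ValuativeRel F] [TopologicalSpace F] [IsNonarchimedeanLocalField F] in
/-- **TRANSFER**: if `ω` is `ψ_nd`- and `ψ‴`-degenerate (`ψ‴(u) = ψ(u₀₁)`), then `ω ∘ ι` is `ψ_nd`- and `ψ′`-degenerate (`ψ′(u) = ψ(u₁₂)`), for every choice of the
characters `θ‴`, `θ′` with those values. [cite: BernsteinZelevinskyASENS1977, §7.1, Thm. 4.7] -/
theorem degenerate_comp_iota (hnd : ∀ v, Coinvariants.mk (whittakerTwist ω ψ) v = 0)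
    (θ₃ : ↥(upperUnitriangular (Fin 3) F) →* ℂˣ) (hθ₃ : ∀ u, ((θ₃ u : ℂˣ) : ℂ) = ψ (((u : GL (Fin 3) F) : Matrix (Fin 3) (Fin 3) F) 0 1))
    (hdeg : ∀ v, Coinvariants.mk (ω.charTwist (upperUnitriangular (Fin 3) F) θ₃) v = 0)
    (θ₁ : ↥(upperUnitriangular (Fin 3) F) →* ℂˣ) (hθ₁ : ∀ u, ((θ₁ u : ℂˣ) : ℂ) = ψ (((u : GL (Fin 3) F) : Matrix (Fin 3) (Fin 3) F) 1 2)) :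
    (∀ v, Coinvariants.mk (whittakerTwist (ω.comp (((glTranspose (Fin 3)).trans (MulEquiv.inv' (GL (Fin 3) F)).symm).trans (MulAut.conj (permGL Fin.revPerm : GL (Fin 3) F))).toMonoidHom) ψ) v = 0) ∧
      ∀ v, Coinvariants.mk (Representation.charTwist (ω.comp (((glTranspose (Fin 3)).trans (MulEquiv.inv' (GL (Fin 3) F)).symm).trans (MulAut.conj (permGL Fin.revPerm : GL (Fin 3) F))).toMonoidHom) (upperUnitriangular (Fin 3) F) θ₁) v = 0 := by
  have hee : ∀ g, (((glTranspose (Fin 3)).trans (MulEquiv.inv' (GL (Fin 3) F)).symm).trans (MulAut.conj (permGL Fin.revPerm : GL (Fin 3) F))).toMonoidHom ((((glTranspose (Fin 3)).trans (MulEquiv.inv' (GL (Fin 3) F)).symm).trans (MulAut.conj (permGL Fin.revPerm : GL (Fin 3) F))).toMonoidHom g) = g := fun g => iota_iota g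
  have heU : ∀ u : ↥(upperUnitriangular (Fin 3) F), (((glTranspose (Fin 3)).trans (MulEquiv.inv' (GL (Fin 3) F)).symm).trans (MulAut.conj (permGL Fin.revPerm : GL (Fin 3) F))).toMonoidHom u ∈ upperUnitriangular (Fin 3) F := fun u => (iota_mem_upperUnitriangular u.2).1
  have hent : ∀ u : ↥(upperUnitriangular (Fin 3) F),
      ((((((glTranspose (Fin 3)).trans (MulEquiv.inv' (GL (Fin 3) F)).symm).trans (MulAut.conj (permGL Fin.revPerm : GL (Fin 3) F))).toMonoidHom u : GL (Fin 3) F)) : Matrix (Fin 3) (Fin 3) F) 0 1 = -((u : GL (Fin 3) F) : Matrix (Fin 3) (Fin 3) F) 1 2 ∧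
      ((((((glTranspose (Fin 3)).trans (MulEquiv.inv' (GL (Fin 3) F)).symm).trans (MulAut.conj (permGL Fin.revPerm : GL (Fin 3) F))).toMonoidHom u : GL (Fin 3) F)) : Matrix (Fin 3) (Fin 3) F) 1 2 = -((u : GL (Fin 3) F) : Matrix (Fin 3) (Fin 3) F) 0 1 :=
    fun u => ⟨(iota_mem_upperUnitriangular u.2).2.1, (iota_mem_upperUnitriangular u.2).2.2⟩
  have hnd' : Coinvariants.ker (whittakerTwist ω ψ) = ⊤ := eq_top_iff.2 fun v _ => (Coinvariants.mk_eq_zero _).1 (hnd v)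
  have hdeg' : Coinvariants.ker (ω.charTwist (upperUnitriangular (Fin 3) F) θ₃) = ⊤ := eq_top_iff.2 fun v _ => (Coinvariants.mk_eq_zero _).1 (hdeg v)
  -- the pulled-back characters and their values
  have hval_nd : ∀ u, (((whittakerChar (n := 3) ψ).comp (((((glTranspose (Fin 3)).trans (MulEquiv.inv' (GL (Fin 3) F)).symm).trans (MulAut.conj (permGL Fin.revPerm : GL (Fin 3) F))).toMonoidHom.restrict _).codRestrict _ heU) u : ℂˣ) : ℂ) =
      ψ (-1 * ((u : GL (Fin 3) F) : Matrix (Fin 3) (Fin 3) F) 0 1 + -1 * ((u : GL (Fin 3) F) : Matrix (Fin 3) (Fin 3) F) 1 2) := by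
    intro u
    rw [MonoidHom.comp_apply, coe_whittakerChar_three]
    refine congrArg (fun z : F => ((ψ z : Circle) : ℂ)) ?_
    change ((((((glTranspose (Fin 3)).trans (MulEquiv.inv' (GL (Fin 3) F)).symm).trans (MulAut.conj (permGL Fin.revPerm : GL (Fin 3) F))).toMonoidHom u : GL (Fin 3) F)) : Matrix (Fin 3) (Fin 3) F) 0 1 + ((((((glTranspose (Fin 3)).trans (MulEquiv.inv' (GL (Fin 3) F)).symm).trans (MulAut.conj (permGL Fin.revPerm : GL (Fin 3) F))).toMonoidHom u : GL (Fin 3) F)) : Matrix (Fin 3) (Fin 3) F) 1 2 = _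
    rw [(hent u).1, (hent u).2]; ring
  have hval' : ∀ u, ((θ₁.comp (((((glTranspose (Fin 3)).trans (MulEquiv.inv' (GL (Fin 3) F)).symm).trans (MulAut.conj (permGL Fin.revPerm : GL (Fin 3) F))).toMonoidHom.restrict _).codRestrict _ heU) u : ℂˣ) : ℂ) =
      ψ (-1 * ((u : GL (Fin 3) F) : Matrix (Fin 3) (Fin 3) F) 0 1 + -0 * ((u : GL (Fin 3) F) : Matrix (Fin 3) (Fin 3) F) 1 2) := by
    intro u
    rw [MonoidHom.comp_apply, hθ₁]
    refine congrArg (fun z : F => ((ψ z : Circle) : ℂ)) ?_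
    change ((((((glTranspose (Fin 3)).trans (MulEquiv.inv' (GL (Fin 3) F)).symm).trans (MulAut.conj (permGL Fin.revPerm : GL (Fin 3) F))).toMonoidHom u : GL (Fin 3) F)) : Matrix (Fin 3) (Fin 3) F) 1 2 = _
    rw [(hent u).2]; ring
  have hnd1 : ∀ u : ↥(upperUnitriangular (Fin 3) F), ((whittakerChar (n := 3) ψ u : ℂˣ) : ℂ) =
      ψ (1 * ((u : GL (Fin 3) F) : Matrix (Fin 3) (Fin 3) F) 0 1 + 1 * ((u : GL (Fin 3) F) : Matrix (Fin 3) (Fin 3) F) 1 2) :=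
    fun u => by rw [coe_whittakerChar_three, one_mul, one_mul]
  have hdeg1 : ∀ u : ↥(upperUnitriangular (Fin 3) F), ((θ₃ u : ℂˣ) : ℂ) =
      ψ (1 * ((u : GL (Fin 3) F) : Matrix (Fin 3) (Fin 3) F) 0 1 + 0 * ((u : GL (Fin 3) F) : Matrix (Fin 3) (Fin 3) F) 1 2) :=
    fun u => by rw [hθ₃, one_mul, zero_mul, add_zero]
  constructor
  · intro v
    rw [Coinvariants.mk_eq_zero]
    have h := ker_charTwist_comp_eq ω (((glTranspose (Fin 3)).trans (MulEquiv.inv' (GL (Fin 3) F)).symm).trans (MulAut.conj (permGL Fin.revPerm : GL (Fin 3) F))).toMonoidHom hee (upperUnitriangular (Fin 3) F) heU (whittakerChar ψ)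
    have htop : Coinvariants.ker (ω.charTwist (upperUnitriangular (Fin 3) F) ((whittakerChar (n := 3) ψ).comp (((((glTranspose (Fin 3)).trans (MulEquiv.inv' (GL (Fin 3) F)).symm).trans (MulAut.conj (permGL Fin.revPerm : GL (Fin 3) F))).toMonoidHom.restrict _).codRestrict _ heU))) = ⊤ :=
      ker_charTwist_eq_top_of_neg ω _ _ hnd1 hval_nd hnd'
    have : Coinvariants.ker (whittakerTwist (ω.comp (((glTranspose (Fin 3)).trans (MulEquiv.inv' (GL (Fin 3) F)).symm).trans (MulAut.conj (permGL Fin.revPerm : GL (Fin 3) F))).toMonoidHom) ψ) = ⊤ := by rw [whittakerTwist, h, htop]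
    rw [this]; exact Submodule.mem_top
  · intro v
    rw [Coinvariants.mk_eq_zero]
    have h := ker_charTwist_comp_eq ω (((glTranspose (Fin 3)).trans (MulEquiv.inv' (GL (Fin 3) F)).symm).trans (MulAut.conj (permGL Fin.revPerm : GL (Fin 3) F))).toMonoidHom hee (upperUnitriangular (Fin 3) F) heU θ₁
    have htop : Coinvariants.ker (ω.charTwist (upperUnitriangular (Fin 3) F) (θ₁.comp (((((glTranspose (Fin 3)).trans (MulEquiv.inv' (GL (Fin 3) F)).symm).trans (MulAut.conj (permGL Fin.revPerm : GL (Fin 3) F))).toMonoidHom.restrict _).codRestrict _ heU))) = ⊤ :=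
      ker_charTwist_eq_top_of_neg ω _ _ hdeg1 hval' hdeg'
    rw [h, htop]; exact Submodule.mem_top

/-- **RULE (lev′): `U₃` ACTS TRIVIALLY** on a `ψ_nd`- and `ψ‴`-degenerate smooth representation of `GL₃(F)` (`ψ‴(u) = ψ(u₀₁)`): transfer of ★ (lev)'s
`apply_eq_self_of_mem_upperUnitriangular_of_degenerate` along `ι` (`u = ι(ι u)`, `ι u ∈ U₃`). [cite: BernsteinZelevinskyASENS1977, Thm. 4.7, §7.1] -/
theorem apply_eq_self_of_mem_upperUnitriangular_of_degenerate' (hψ : ψ.IsContinuousNontrivial) (hω : ω.IsSmooth)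
    (hnd : ∀ v, Coinvariants.mk (whittakerTwist ω ψ) v = 0)
    (θ₃ : ↥(upperUnitriangular (Fin 3) F) →* ℂˣ) (hθ₃ : ∀ u, ((θ₃ u : ℂˣ) : ℂ) = ψ (((u : GL (Fin 3) F) : Matrix (Fin 3) (Fin 3) F) 0 1))
    (hdeg : ∀ v, Coinvariants.mk (ω.charTwist (upperUnitriangular (Fin 3) F) θ₃) v = 0)
    {u : GL (Fin 3) F} (hu : u ∈ upperUnitriangular (Fin 3) F) (v : V) : ω u v = v := by
  haveI : IsTopologicalRing F := inferInstance
  obtain ⟨θ₁, hθ₁⟩ := exists_character_upperUnitriangular ψ 0 1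
  have hθ₁' : ∀ w, ((θ₁ w : ℂˣ) : ℂ) = ψ (((w : GL (Fin 3) F) : Matrix (Fin 3) (Fin 3) F) 1 2) := fun w => by rw [hθ₁, zero_mul, one_mul, zero_add]
  obtain ⟨hnd', hdeg'⟩ := degenerate_comp_iota ω hnd θ₃ hθ₃ hdeg θ₁ hθ₁'
  have hω' : Representation.IsSmooth (ω.comp (((glTranspose (Fin 3)).trans (MulEquiv.inv' (GL (Fin 3) F)).symm).trans (MulAut.conj (permGL Fin.revPerm : GL (Fin 3) F))).toMonoidHom) := hω.comp _ continuous_iota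
  have key := apply_eq_self_of_mem_upperUnitriangular_of_degenerate _ hψ hω' hnd' θ₁ hθ₁' hdeg' (iota_mem_upperUnitriangular hu).1 v
  rw [MonoidHom.comp_apply, MulEquiv.coe_toMonoidHom, iota_iota] at key
  exact key

variable [ω.IsIrreducible]

/-- **RULE (lev′): A `ψ_nd`- AND `ψ‴`-DEGENERATE IRREDUCIBLE SMOOTH REPRESENTATION OF `GL₃(F)` IS ONE-DIMENSIONAL** (`ψ‴(u) = ψ(u₀₁)`, the mirror of ★ (lev)):
`Module.finrank ℂ V = 1`. [cite: BernsteinZelevinskyASENS1977, Thm. 4.7, §7.1] [cite: Zelevinsky1980, 4.3] -/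
theorem finrank_eq_one_of_degenerate' (hψ : ψ.IsContinuousNontrivial) (hω : ω.IsSmooth) (hnd : ∀ v, Coinvariants.mk (whittakerTwist ω ψ) v = 0)
    (θ₃ : ↥(upperUnitriangular (Fin 3) F) →* ℂˣ) (hθ₃ : ∀ u, ((θ₃ u : ℂˣ) : ℂ) = ψ (((u : GL (Fin 3) F) : Matrix (Fin 3) (Fin 3) F) 0 1))
    (hdeg : ∀ v, Coinvariants.mk (ω.charTwist (upperUnitriangular (Fin 3) F) θ₃) v = 0) : Module.finrank ℂ V = 1 := by
  haveI : IsTopologicalRing F := inferInstance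
  obtain ⟨θ₁, hθ₁⟩ := exists_character_upperUnitriangular ψ 0 1
  have hθ₁' : ∀ w, ((θ₁ w : ℂˣ) : ℂ) = ψ (((w : GL (Fin 3) F) : Matrix (Fin 3) (Fin 3) F) 1 2) := fun w => by rw [hθ₁, zero_mul, one_mul, zero_add]
  obtain ⟨hnd', hdeg'⟩ := degenerate_comp_iota ω hnd θ₃ hθ₃ hdeg θ₁ hθ₁'
  haveI : Representation.IsIrreducible (ω.comp (((glTranspose (Fin 3)).trans (MulEquiv.inv' (GL (Fin 3) F)).symm).trans (MulAut.conj (permGL Fin.revPerm : GL (Fin 3) F))).toMonoidHom) := isIrreducible_comp_of_surjective ω _ (((glTranspose (Fin 3)).trans (MulEquiv.inv' (GL (Fin 3) F)).symm).trans (MulAut.conj (permGL Fin.revPerm : GL (Fin 3) F))).surjective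
  have hω' : Representation.IsSmooth (ω.comp (((glTranspose (Fin 3)).trans (MulEquiv.inv' (GL (Fin 3) F)).symm).trans (MulAut.conj (permGL Fin.revPerm : GL (Fin 3) F))).toMonoidHom) := hω.comp _ continuous_iota
  exact finrank_eq_one_of_degenerate (ω.comp (((glTranspose (Fin 3)).trans (MulEquiv.inv' (GL (Fin 3) F)).symm).trans (MulAut.conj (permGL Fin.revPerm : GL (Fin 3) F))).toMonoidHom) hψ hω' hnd' θ₁ hθ₁' hdeg'

omit [ω.IsIrreducible] in
/-- **The Borel Jacquet kernel of a `ψ_nd`+`ψ‴`-degenerate representation is `⊥`.** [cite: BernsteinZelevinskyASENS1977, Thm. 4.7] -/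
theorem ker_restrictUnipotentGL_eq_bot_of_degenerate' (hψ : ψ.IsContinuousNontrivial) (hω : ω.IsSmooth)
    (hnd : ∀ v, Coinvariants.mk (whittakerTwist ω ψ) v = 0)
    (θ₃ : ↥(upperUnitriangular (Fin 3) F) →* ℂˣ) (hθ₃ : ∀ u, ((θ₃ u : ℂˣ) : ℂ) = ψ (((u : GL (Fin 3) F) : Matrix (Fin 3) (Fin 3) F) 0 1))
    (hdeg : ∀ v, Coinvariants.mk (ω.charTwist (upperUnitriangular (Fin 3) F) θ₃) v = 0) :
    Coinvariants.ker (restrictUnipotentGL F (id : Fin 3 → Fin 3) ω) = ⊥ := by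
  refine (Submodule.eq_bot_iff _).2 fun x hx => ?_
  refine Submodule.span_induction (fun y hy => ?_) rfl (fun a b _ _ ha hb => by rw [ha, hb, add_zero]) (fun c a _ ha => by rw [ha, smul_zero]) hx
  obtain ⟨⟨u, v⟩, rfl⟩ := hy
  have hu : ((u : ↥(standardParabolicGL F (id : Fin 3 → Fin 3))) : GL (Fin 3) F) ∈ upperUnitriangular (Fin 3) F :=
    ⟨(u : ↥(standardParabolicGL F (id : Fin 3 → Fin 3))), u.2, rfl⟩
  show ω ((u : ↥(standardParabolicGL F (id : Fin 3 → Fin 3))) : GL (Fin 3) F) v - v = 0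
  rw [apply_eq_self_of_mem_upperUnitriangular_of_degenerate' ω hψ hω hnd θ₃ hθ₃ hdeg hu, sub_self]

/-- **RULE (lev′), JACQUET FORM: `dim r_B(ω) = 1`** for `ω` irreducible smooth on `GL₃(F)` with `ω_{U₃,ψ_nd} = 0` and `ω_{U₃,ψ‴} = 0` (`ψ‴(u) = ψ(u₀₁)`).
[cite: BernsteinZelevinskyASENS1977, Thm. 4.7] [cite: Zelevinsky1980, 4.3] -/
theorem finrank_coinvariants_restrictUnipotentGL_eq_one_of_degenerate' (hψ : ψ.IsContinuousNontrivial) (hω : ω.IsSmooth)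
    (hnd : ∀ v, Coinvariants.mk (whittakerTwist ω ψ) v = 0)
    (θ₃ : ↥(upperUnitriangular (Fin 3) F) →* ℂˣ) (hθ₃ : ∀ u, ((θ₃ u : ℂˣ) : ℂ) = ψ (((u : GL (Fin 3) F) : Matrix (Fin 3) (Fin 3) F) 0 1))
    (hdeg : ∀ v, Coinvariants.mk (ω.charTwist (upperUnitriangular (Fin 3) F) θ₃) v = 0) :
    Module.finrank ℂ (restrictUnipotentGL F (id : Fin 3 → Fin 3) ω).Coinvariants = 1 := by
  have hbot := ker_restrictUnipotentGL_eq_bot_of_degenerate' ω hψ hω hnd θ₃ hθ₃ hdeg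
  have e : (restrictUnipotentGL F (id : Fin 3 → Fin 3) ω).Coinvariants ≃ₗ[ℂ] V := Submodule.quotEquivOfEqBot _ hbot
  rw [e.finrank_eq, finrank_eq_one_of_degenerate' ω hψ hω hnd θ₃ hθ₃ hdeg]

end Mirror

end Summit.HodgeConjecture.HodgeConjecture.Cruxes.H413.K2E3GL3DegenerateLevelOneMirror

end
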